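import Summits.QuantumFields.BalabanUV.Beta.EriceRemainderEnclosureHistoryAutonomyComparisonAgeCompositionNearPairSeparatedAges
import Summits.QuantumFields.BalabanUV.Beta.EriceRemainderEnclosureHistoryAutonomyComparisonAgeCompositionClusterLevelsYoungest

/-!
# EriceRemainderEnclosureHistoryAutonomyComparisonAgeCompositionNearPairSeparatedAgesEvery — (E99f) route (N), first order: NEAR OLD PAIRS AS LEVELS ABOVE
# ANY YOUNG AGE AT RATIO 30, and the census four ages `{1, k₂, k₃, k₄}` with a near old pair on top (`61k₂ ≤ k₃ < k₄ ≤ 2k₃`) at EVERY `k₂ ≥ 2`.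
# (E99d) closed `2 ≤ k₂ ≤ 29` (young-pair level, engine (E95c)) and `k₂ ≥ 59` (young age + ×59); the middle `30 ≤ k₂ ≤ 58` is the business of the
# sharp-last-step engine (E96a), instantiated for clusters in (E99e): the young age `{a₀}` (cap `0.7072`) at ratio `ρ₀ = 30` below the first older
# level, near old pairs `{a_j, p_j}` (cap `0.617`, (E99b); a single age when `p_j = a_j`, cap from age `22`) in ×61 separation above —
# **`flow_nonneg_young_age_gap_near_pairs`** (`κ = 1∕5`: older closure `3.1616 ≤ 3.16712`, last step `0.7072·(30·0.2596 + 3.1616) = 7.7436 ≤ 7.788`),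
# **`flow_nonneg_census_four_ages_near_old_pair_mid`** (`k₂ ≥ 30`), **`flow_nonneg_census_four_ages_near_old_pair_every`** (EVERY `k₂ ≥ 2`), and the
# census young pair below a ×61 chain of near old pairs at every `k₂`, **`flow_nonneg_census_young_pair_every_near_pairs`**

Cell `pub-balaban`, β-function sub-cell, BINDER row D4 «RemainderConst leaves for Bałaban's split» (`HOME/BINDER-OWNERS.md`; owner lineage `b2b-balaban-beta-an4`;
this file by co-owner #2 lineage `b2b-balaban-beta-d4-p2`, generation 87), β-FLOW TEAM duty (1), FREEZE (0) honoured (def-free; nothing restated).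

HONEST FRAMING (page 1, verbatim and binding).  *"Discharging BetaPertH makes Bałaban's UV stability UNCONDITIONAL — a real constructive-QFT result; it is
NOT the continuum limit and NOT the Clay problem."*  THIS FILE DISCHARGES NOTHING OF THE KIND.  Elementary real algebra ∕ real analysis about ABSTRACT
functionals on a box ]0,γ]^ℕ with displayed floors, profiles and signs, and the FIRST-ORDER renewal objects of route (N) built from them — hypotheses of a
census, not facts; the form, signs, ages and moments of Bałaban's (1.22) limit functional are NOT PRINTED ([I] p. 298; GAPS G-t4-U2-1∕-2) and NOT asserted.
Row D4 class UNCHANGED (critical-path width 0; instance 0∕1; D4 DISCHARGE NO DATE).  HONEST DEPENDENCY: continuum YM on T⁴ ⇐ BetaPertH ∧ nine spine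
estimates (0/9 proved); BetaPertH ⇐ (D1) ∧ (D4) ∧ CAP+tail; G-an2-4 gates asym, D1 and NE2/3/4.

THE POINT (README `HOME/b2b-balaban-beta-d4-p2/g87/README.md` §3).  Uses (E99e) `flow_nonneg_cluster_levels_of_caps_youngest`, (E99b) `near_pair_load_le`,
(E99d) `flow_nonneg_census_four_ages_near_old_pair`∕`flow_nonneg_census_young_pair_near_pairs`, (E94b) `load_le_of_sq` BY NAME.  NOT CLAIMED: spans
`p_j > 2a_j`; consecutive older ratios below 61; anything printed — NOT B12 Thm 2, NOT BetaPertH, NOT continuum, NOT Clay.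

WHAT IS PROVED ([folklore]; 0 `def`, 0 sorry).  §1 **`flow_nonneg_young_age_gap_near_pairs`**.  §2 **`flow_nonneg_census_four_ages_near_old_pair_mid`**,
**`flow_nonneg_census_four_ages_near_old_pair_every`**.  §3 **`flow_nonneg_census_young_pair_every_near_pairs`**.
-/
noncomputable section
open Finset

namespace Summit.QuantumFields.BalabanUV.Beta.EriceRemainderEnclosureHistoryAutonomyComparisonAgeCompositionNearPairSeparatedAgesEvery

open Literature.MathematicalPhysics.QuantumFieldTheory.Balaban1983to89
open Literature.MathematicalPhysics.QuantumFieldTheory.Balaban1983to89.T4BetaStationary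
open Literature.MathematicalPhysics.QuantumFieldTheory.Balaban1983to89.T4BetaFlowWellPosed
open Summit.QuantumFields.BalabanUV.Beta.EriceRemainderEnclosureHistoryAutonomyComparisonAgeCompositionYoungPairMoment (load_le_of_sq)
open Summit.QuantumFields.BalabanUV.Beta.EriceRemainderEnclosureHistoryAutonomyComparisonAgeCompositionOldPairCap (near_pair_load_le)
open Summit.QuantumFields.BalabanUV.Beta.EriceRemainderEnclosureHistoryAutonomyComparisonAgeCompositionClusterLevelsYoungest
  (flow_nonneg_cluster_levels_of_caps_youngest)
open Summit.QuantumFields.BalabanUV.Beta.EriceRemainderEnclosureHistoryAutonomyComparisonAgeCompositionNearPairSeparatedAges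
  (flow_nonneg_census_four_ages_near_old_pair flow_nonneg_census_young_pair_near_pairs)

variable {B : (ℕ → ℝ) → ℝ} {γ b gIR : ℝ} {L : ℕ → ℝ} {K : ℕ} {h g : ℕ → ℝ}

/-! ## §1 Any young age at ratio 30 below a ×61 chain of near old pairs -/

/-- **ANY YOUNG AGE AT RATIO 30 BELOW A ×61 CHAIN OF NEAR OLD PAIRS, ANY NUMBER OF LEVELS.**  Along every box solution of an isotone dominated memory with
floor (`L ≥ 0`) and every damping of the self-consistent class; profile carried by `{a₀} ∪ ⋃_{1≤j<r} {a j, p j}` with `a₀ ≥ 1` ARBITRARY,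
`a j ≤ p j ≤ 2·a j` (`56 ≤ a j` when `a j < p j`; `p j < K`), `30·a₀ ≤ a 1`, `61·p j ≤ a (j+1)`: `0 ≤ ε ≤ e` at every pin, every horizon ((E99e) with
`κ = 1∕5`, `s = 0.617`, `s₀ = 0.7072`, `ρ₀ = 30`, `R₀ = 61`; caps (E94b) `load_le_of_sq`, (E99b) `near_pair_load_le`). [folklore] -/
theorem flow_nonneg_young_age_gap_near_pairs
    (hmono : ∀ u v : ℕ → ℝ, SeqBox γ u → SeqBox γ v → (∀ j, u j ≤ v j) → B u ≤ B v)
    (hL : ∀ k, 0 ≤ L k) (hb : 0 < b) (hlo : ∀ u, SeqBox γ u → b ≤ B u) (hdom : ∀ u, SeqBox γ u → ∑ k ∈ range K, L k * u k ≤ B u)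
    (hh : SeqBox γ h) (hf : MemFlow B gIR h) (hg : ∀ t, 0 < g t ∧ g t ≤ 1)
    (hgF : ∀ t, 1 ≤ g t * (1 + ∑ k ∈ range K, L k * h (t + k) ^ 3 / 2))
    {a₀ : ℕ} (ha0 : 1 ≤ a₀) (ha0K : a₀ < K)
    {r : ℕ} {a p : ℕ → ℕ} (hr : 1 ≤ r) (hap : ∀ j, 1 ≤ j → j < r → a j ≤ p j ∧ p j ≤ 2 * a j)
    (h56 : ∀ j, 1 ≤ j → j < r → a j < p j → 56 ≤ a j) (hpK : ∀ j, 1 ≤ j → j < r → p j < K)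
    (hsep0 : 1 < r → 30 * a₀ ≤ a 1) (hsep : ∀ j, 1 ≤ j → j + 1 < r → 61 * p j ≤ a (j + 1))
    (hLa : ∀ l, l < K → l ≠ a₀ → (∀ j, 1 ≤ j → j < r → l ≠ a j ∧ l ≠ p j) → L l = 0)
    {N : ℕ} {KL : ℕ → ℕ → ℕ → ℝ}
    (hKL : ∀ k n l, KL k n l = if 0 < k ∧ k < K ∧ l < k then L k * h (n + k) ^ 3 / 2 * ∏ t ∈ Ico (n + 1 + l) (n + k + 1), g t else 0)
    {KA : ℕ → ℕ → ℕ → ℝ} {RA : ℕ → (ℕ → ℝ) → ℕ → ℝ}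
    (hRA : ∀ i v m, RA i v m = ∑ l ∈ range K, KA i m l * v (m + 1 + l))
    (hKA : ∀ i m l, KA i m l = KL i m l + KA (i + 1) m l) (hKAtop : ∀ m l, KA K m l = 0)
    {e ε : ℕ → ℝ} (he0 : ∀ m, 0 ≤ e m) (hea : ∀ m, e (m + 1) ≤ e m)
    (hεt : ∀ m, N < m → ε m = 0) (hεrec : ∀ m, ε m = e m - RA 1 ε m) : ∀ m, 0 ≤ ε m ∧ ε m ≤ e m := by
  -- the window of each level and the chain of separations (ratio ≥ 30 everywhere)
  obtain ⟨HI, hHI⟩ : ∃ HI : ℕ → ℕ, ∀ j, HI j = if j = 0 then a₀ else p j := ⟨_, fun _ => rfl⟩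
  have hHI0 : HI 0 = a₀ := by rw [hHI]; simp
  have hHIS : ∀ j, 1 ≤ j → HI j = p j := fun j hj => by rw [hHI, if_neg (by omega)]
  have hchain : ∀ i j, i < j → j < r → 30 * HI i ≤ a j := by
    intro i j hij hjr
    induction j, hij using Nat.le_induction with
    | base =>
      rcases Nat.eq_zero_or_pos i with rfl | hi
      · rw [hHI0]; exact hsep0 (by omega)
      · rw [hHIS i hi]; exact le_trans (Nat.mul_le_mul_right _ (by norm_num)) (hsep i hi (by omega))
    | succ j hle ih =>
      have h1 := ih (by omega)
      have h2 := hsep j (by omega) hjr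
      have h3 := (hap j (by omega) (by omega)).1
      omega
  have ha30 : ∀ j, 1 ≤ j → j < r → 30 ≤ a j := by
    intro j hj hjr
    have := hchain 0 j (by omega) hjr
    rw [hHI0] at this; omega
  refine flow_nonneg_cluster_levels_of_caps_youngest hmono hL hb hlo hdom hh hf hg hgF (by omega) (κ := 1 / 5) (s₀ := 7072 / 10000)
    (s := 617 / 1000) (R₀ := 61) (ρ₀ := 30) (by norm_num) (by norm_num) (by norm_num) (by norm_num) (by norm_num) (by norm_num)
    (r := r) (S := fun j => if j = 0 then {a₀} else {a j, p j}) (lo := fun j => if j = 0 then a₀ else a j) (hi := HI)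
    (fun j hj k hk => ?_) (fun j hj k hk => ?_) (fun j hj k hk => ?_) (fun j hj1 hjr => ?_) (fun h1r => ?_) (fun j hj1 hj => ?_)
    (fun i j hij hjr => ?_) (fun l hl hno => ?_) (fun q => ?_) (fun j q hj1 hjr => ?_) hKL hRA hKA hKAtop he0 hea hεt hεrec
  · -- members are ages in [1, K)
    by_cases hj0 : j = 0
    · subst hj0; simp only [if_true, mem_singleton] at hk; subst hk; exact ⟨ha0, ha0K⟩
    · simp only [if_neg hj0, mem_insert, mem_singleton] at hk
      have h1 := ha30 j (by omega) hj; have h2 := hap j (by omega) hj; have h3 := hpK j (by omega) hj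
      rcases hk with rfl | rfl <;> omega
  · -- members are ≥ lo
    by_cases hj0 : j = 0
    · subst hj0; simp only [if_true, mem_singleton] at hk ⊢; omega
    · simp only [if_neg hj0, mem_insert, mem_singleton] at hk ⊢
      have h2 := hap j (by omega) hj
      rcases hk with rfl | rfl <;> omega
  · -- members are ≤ hi
    by_cases hj0 : j = 0
    · subst hj0; simp only [if_true, mem_singleton] at hk; rw [hHI0]; omega
    · simp only [if_neg hj0, mem_insert, mem_singleton] at hk
      rw [hHIS j (by omega)]
      have h2 := hap j (by omega) hj
      rcases hk with rfl | rfl <;> omega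
  · -- lo ≤ hi for the older levels
    simp only [if_neg (show j ≠ 0 by omega)]
    rw [hHIS j hj1]; exact (hap j hj1 hjr).1
  · -- the youngest gap: 30·a₀ ≤ a 1
    simp only [if_neg (show (1 : ℕ) ≠ 0 by norm_num)]
    rw [hHI0]; exact hsep0 h1r
  · -- the older separations: 61·p j ≤ a (j+1)
    simp only [if_neg (Nat.succ_ne_zero j)]
    rw [hHIS j hj1]; exact hsep j hj1 hj
  · -- the clusters are pairwise disjoint
    have hlt : ∀ x, x ∈ (if i = 0 then ({a₀} : Finset ℕ) else ({a i, p i} : Finset ℕ)) →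
        ∀ y, y ∈ (if j = 0 then ({a₀} : Finset ℕ) else ({a j, p j} : Finset ℕ)) → x < y := by
      intro x hx y hy
      have hj0 : j ≠ 0 := by omega
      simp only [if_neg hj0, mem_insert, mem_singleton] at hy
      have hc := hchain i j hij hjr
      have hay : a j ≤ y := by have := (hap j (by omega) hjr).1; rcases hy with rfl | rfl <;> omega
      have hxH : 1 ≤ x ∧ x ≤ HI i := by
        by_cases hi0 : i = 0
        · subst hi0; simp only [if_true, mem_singleton] at hx; rw [hHI0]; omega
        · simp only [if_neg hi0, mem_insert, mem_singleton] at hx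
          rw [hHIS i (by omega)]
          have h1 := ha30 i (by omega) (by omega); have h2 := hap i (by omega) (by omega)
          rcases hx with rfl | rfl <;> omega
      omega
    exact disjoint_left.mpr fun x hx hx' => lt_irrefl x (hlt x hx x hx')
  · -- the profile vanishes off the clusters
    refine hLa l hl (by simpa using hno 0 (by omega)) fun j hj1 hjr => ?_
    have := hno j hjr
    simp only [if_neg (show j ≠ 0 by omega), mem_insert, mem_singleton, not_or] at this
    exact this
  · -- the youngest cap: any age carries at most 0.7072
    simp only [if_true, sum_singleton]
    have ha0r : (1 : ℝ) ≤ a₀ := by exact_mod_cast ha0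
    exact load_le_of_sq hmono hL hb hlo hdom hh hf ha0 ha0K (so := 7072 / 10000) (by norm_num) (by nlinarith) q
  · -- the older caps: one age from 22 on, or a near old pair (E99b)
    simp only [if_neg (show j ≠ 0 by omega)]
    have h2 := hap j hj1 hjr
    rcases h2.1.eq_or_lt with heq | hlt
    · rw [← heq, insert_eq_of_mem (mem_singleton_self _), sum_singleton]
      have har : (30 : ℝ) ≤ a j := by exact_mod_cast ha30 j hj1 hjr
      have haK : a j < K := by have := hpK j hj1 hjr; omega
      exact load_le_of_sq hmono hL hb hlo hdom hh hf (by have := ha30 j hj1 hjr; omega) haK (so := 617 / 1000) (by norm_num)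
        (by nlinarith) q
    · exact near_pair_load_le hmono hL hb hlo hdom hh hf (h56 j hj1 hjr hlt) h2.1 h2.2 (hpK j hj1 hjr) q

/-! ## §2 The census four ages with a near old pair on top, every k₂ -/

/-- **THE CENSUS FOUR AGES `{1, k₂, k₃, k₄}` WITH A NEAR OLD PAIR, MIDDLE AND FAR YOUNG PART: `k₂ ≥ 30`, `61k₂ ≤ k₃`, `k₃ < k₄ ≤ 2k₃`.**
`0 ≤ ε ≤ e` at every pin (`flow_nonneg_young_age_gap_near_pairs` with `a₀ = 1`, the single level `{k₂}` and the pair `{k₃, k₄}`). [folklore] -/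
theorem flow_nonneg_census_four_ages_near_old_pair_mid
    (hmono : ∀ u v : ℕ → ℝ, SeqBox γ u → SeqBox γ v → (∀ j, u j ≤ v j) → B u ≤ B v)
    (hL : ∀ k, 0 ≤ L k) (hb : 0 < b) (hlo : ∀ u, SeqBox γ u → b ≤ B u) (hdom : ∀ u, SeqBox γ u → ∑ k ∈ range K, L k * u k ≤ B u)
    (hh : SeqBox γ h) (hf : MemFlow B gIR h) (hg : ∀ t, 0 < g t ∧ g t ≤ 1)
    (hgF : ∀ t, 1 ≤ g t * (1 + ∑ k ∈ range K, L k * h (t + k) ^ 3 / 2))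
    {k₂ k₃ k₄ : ℕ} (hk2 : 30 ≤ k₂) (hk3 : 61 * k₂ ≤ k₃) (hk34 : k₃ < k₄) (hk4 : k₄ ≤ 2 * k₃) (hk4K : k₄ < K)
    (hLa : ∀ l, l < K → l ≠ 1 → l ≠ k₂ → l ≠ k₃ → l ≠ k₄ → L l = 0)
    {N : ℕ} {KL : ℕ → ℕ → ℕ → ℝ}
    (hKL : ∀ k n l, KL k n l = if 0 < k ∧ k < K ∧ l < k then L k * h (n + k) ^ 3 / 2 * ∏ t ∈ Ico (n + 1 + l) (n + k + 1), g t else 0)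
    {KA : ℕ → ℕ → ℕ → ℝ} {RA : ℕ → (ℕ → ℝ) → ℕ → ℝ}
    (hRA : ∀ i v m, RA i v m = ∑ l ∈ range K, KA i m l * v (m + 1 + l))
    (hKA : ∀ i m l, KA i m l = KL i m l + KA (i + 1) m l) (hKAtop : ∀ m l, KA K m l = 0)
    {e ε : ℕ → ℝ} (he0 : ∀ m, 0 ≤ e m) (hea : ∀ m, e (m + 1) ≤ e m)
    (hεt : ∀ m, N < m → ε m = 0) (hεrec : ∀ m, ε m = e m - RA 1 ε m) : ∀ m, 0 ≤ ε m ∧ ε m ≤ e m := by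
  refine flow_nonneg_young_age_gap_near_pairs hmono hL hb hlo hdom hh hf hg hgF (a₀ := 1) le_rfl (by omega)
    (r := 3) (a := fun j => if j = 1 then k₂ else k₃) (p := fun j => if j = 1 then k₂ else k₄) (by norm_num)
    (fun j hj1 hj3 => ?_) (fun j hj1 hj3 hlt => ?_) (fun j hj1 hj3 => ?_) (fun _ => by simpa using hk2) (fun j hj1 hj3 => ?_)
    (fun l hl h1 hno => ?_) hKL hRA hKA hKAtop he0 hea hεt hεrec
  · by_cases hj : j = 1
    · simp only [hj, if_true]; omega
    · simp only [if_neg hj]; omega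
  · by_cases hj : j = 1
    · simp only [hj, if_true, lt_irrefl] at hlt
    · simp only [if_neg hj]; omega
  · by_cases hj : j = 1
    · simp only [hj, if_true]; omega
    · simp only [if_neg hj]; exact hk4K
  · have hj : j = 1 := by omega
    subst hj; simp only [if_true, show (1 + 1 : ℕ) ≠ 1 by norm_num, if_false]; omega
  · have h2 := hno 1 le_rfl (by norm_num)
    have h3 := hno 2 (by norm_num) (by norm_num)
    simp only [if_true] at h2
    simp only [show (2 : ℕ) ≠ 1 by norm_num, if_false] at h3
    exact hLa l hl h1 h2.1 h3.1 h3.2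

/-- **THE CENSUS FOUR AGES `{1, k₂, k₃, k₄}` WITH A NEAR OLD PAIR ON TOP, EVERY `k₂`: `k₂ ≥ 2` ARBITRARY, `61k₂ ≤ k₃`, `k₃ < k₄ ≤ 2k₃`.**
`0 ≤ ε ≤ e` at every pin, every horizon, every damping of the self-consistent class (`k₂ ≤ 29`: (E99d) `flow_nonneg_census_four_ages_near_old_pair`;
`k₂ ≥ 30`: `flow_nonneg_census_four_ages_near_old_pair_mid`).  With (E97c) `flow_nonneg_census_four_ages_sixtyone` (`k₄ ≥ 61k₃`) the top ratio
`k₄∕k₃` may now lie in `(1, 2] ∪ [61, ∞)`. [folklore] -/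
theorem flow_nonneg_census_four_ages_near_old_pair_every
    (hmono : ∀ u v : ℕ → ℝ, SeqBox γ u → SeqBox γ v → (∀ j, u j ≤ v j) → B u ≤ B v)
    (hL : ∀ k, 0 ≤ L k) (hb : 0 < b) (hlo : ∀ u, SeqBox γ u → b ≤ B u) (hdom : ∀ u, SeqBox γ u → ∑ k ∈ range K, L k * u k ≤ B u)
    (hh : SeqBox γ h) (hf : MemFlow B gIR h) (hg : ∀ t, 0 < g t ∧ g t ≤ 1)
    (hgF : ∀ t, 1 ≤ g t * (1 + ∑ k ∈ range K, L k * h (t + k) ^ 3 / 2))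
    {k₂ k₃ k₄ : ℕ} (hk2 : 2 ≤ k₂) (hk3 : 61 * k₂ ≤ k₃) (hk34 : k₃ < k₄) (hk4 : k₄ ≤ 2 * k₃) (hk4K : k₄ < K)
    (hLa : ∀ l, l < K → l ≠ 1 → l ≠ k₂ → l ≠ k₃ → l ≠ k₄ → L l = 0)
    {N : ℕ} {KL : ℕ → ℕ → ℕ → ℝ}
    (hKL : ∀ k n l, KL k n l = if 0 < k ∧ k < K ∧ l < k then L k * h (n + k) ^ 3 / 2 * ∏ t ∈ Ico (n + 1 + l) (n + k + 1), g t else 0)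
    {KA : ℕ → ℕ → ℕ → ℝ} {RA : ℕ → (ℕ → ℝ) → ℕ → ℝ}
    (hRA : ∀ i v m, RA i v m = ∑ l ∈ range K, KA i m l * v (m + 1 + l))
    (hKA : ∀ i m l, KA i m l = KL i m l + KA (i + 1) m l) (hKAtop : ∀ m l, KA K m l = 0)
    {e ε : ℕ → ℝ} (he0 : ∀ m, 0 ≤ e m) (hea : ∀ m, e (m + 1) ≤ e m)
    (hεt : ∀ m, N < m → ε m = 0) (hεrec : ∀ m, ε m = e m - RA 1 ε m) : ∀ m, 0 ≤ ε m ∧ ε m ≤ e m := by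
  rcases le_or_gt k₂ 29 with h29 | h30
  · exact flow_nonneg_census_four_ages_near_old_pair hmono hL hb hlo hdom hh hf hg hgF hk2 h29 hk3 hk34 hk4 hk4K hLa hKL hRA hKA hKAtop
      he0 hea hεt hεrec
  · exact flow_nonneg_census_four_ages_near_old_pair_mid hmono hL hb hlo hdom hh hf hg hgF (by omega) hk3 hk34 hk4 hk4K hLa hKL hRA hKA hKAtop
      he0 hea hεt hεrec

/-! ## §3 The census young pair at every k₂ below a ×61 chain of near old pairs -/

/-- **THE CENSUS YOUNG PAIR `{1, k₂}` AT EVERY `k₂` BELOW A ×61 CHAIN OF NEAR OLD PAIRS, ANY NUMBER OF LEVELS.**  Profile carried by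
`{1, k₂} ∪ ⋃_{1≤j<r} {a j, p j}` with `k₂ ≥ 2` ARBITRARY, `a j ≤ p j ≤ 2·a j` (`p j < K`), `61k₂ ≤ a 1`, `61·p j ≤ a (j+1)`: `0 ≤ ε ≤ e` at every pin,
every horizon, every damping of the self-consistent class (`k₂ ≤ 29`: (E99d) `flow_nonneg_census_young_pair_near_pairs`; `k₂ ≥ 30`: §1 with the young
age `1`, the single level `{k₂}` at ratio `≥ 30` and the pairs re-indexed one level up).  (E97c) `flow_nonneg_census_young_pair_every_sixtyone` is the case
`p j = a j`. [folklore] -/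
theorem flow_nonneg_census_young_pair_every_near_pairs
    (hmono : ∀ u v : ℕ → ℝ, SeqBox γ u → SeqBox γ v → (∀ j, u j ≤ v j) → B u ≤ B v)
    (hL : ∀ k, 0 ≤ L k) (hb : 0 < b) (hlo : ∀ u, SeqBox γ u → b ≤ B u) (hdom : ∀ u, SeqBox γ u → ∑ k ∈ range K, L k * u k ≤ B u)
    (hh : SeqBox γ h) (hf : MemFlow B gIR h) (hg : ∀ t, 0 < g t ∧ g t ≤ 1)
    (hgF : ∀ t, 1 ≤ g t * (1 + ∑ k ∈ range K, L k * h (t + k) ^ 3 / 2))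
    {k₂ : ℕ} (hk2 : 2 ≤ k₂) (hk2K : k₂ < K)
    {r : ℕ} {a p : ℕ → ℕ} (hr : 1 ≤ r) (hap : ∀ j, 1 ≤ j → j < r → a j ≤ p j ∧ p j ≤ 2 * a j) (hpK : ∀ j, 1 ≤ j → j < r → p j < K)
    (hsep0 : 1 < r → 61 * k₂ ≤ a 1) (hsep : ∀ j, 1 ≤ j → j + 1 < r → 61 * p j ≤ a (j + 1))
    (hLa : ∀ l, l < K → l ≠ 1 → l ≠ k₂ → (∀ j, 1 ≤ j → j < r → l ≠ a j ∧ l ≠ p j) → L l = 0)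
    {N : ℕ} {KL : ℕ → ℕ → ℕ → ℝ}
    (hKL : ∀ k n l, KL k n l = if 0 < k ∧ k < K ∧ l < k then L k * h (n + k) ^ 3 / 2 * ∏ t ∈ Ico (n + 1 + l) (n + k + 1), g t else 0)
    {KA : ℕ → ℕ → ℕ → ℝ} {RA : ℕ → (ℕ → ℝ) → ℕ → ℝ}
    (hRA : ∀ i v m, RA i v m = ∑ l ∈ range K, KA i m l * v (m + 1 + l))
    (hKA : ∀ i m l, KA i m l = KL i m l + KA (i + 1) m l) (hKAtop : ∀ m l, KA K m l = 0)
    {e ε : ℕ → ℝ} (he0 : ∀ m, 0 ≤ e m) (hea : ∀ m, e (m + 1) ≤ e m)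
    (hεt : ∀ m, N < m → ε m = 0) (hεrec : ∀ m, ε m = e m - RA 1 ε m) : ∀ m, 0 ≤ ε m ∧ ε m ≤ e m := by
  rcases le_or_gt k₂ 29 with h29 | h30
  · exact flow_nonneg_census_young_pair_near_pairs hmono hL hb hlo hdom hh hf hg hgF hk2 h29 hk2K hr hap hpK hsep0 hsep hLa hKL hRA hKA hKAtop
      he0 hea hεt hεrec
  · -- k₂ ≥ 30: the young age 1, the single level {k₂} at ratio ≥ 30, the pairs one level up
    have hgrow : ∀ j, 1 ≤ j → j < r → 61 * k₂ ≤ a j := by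
      intro j hj hjr
      induction j, hj using Nat.le_induction with
      | base => exact hsep0 (by omega)
      | succ j hle ih =>
        have h1 := ih (by omega); have h2 := hsep j hle hjr; have h3 := (hap j hle (by omega)).1
        omega
    refine flow_nonneg_young_age_gap_near_pairs hmono hL hb hlo hdom hh hf hg hgF (a₀ := 1) le_rfl (by omega)
      (r := r + 1) (a := fun j => if j = 1 then k₂ else a (j - 1)) (p := fun j => if j = 1 then k₂ else p (j - 1)) (by omega)
      (fun j hj1 hjr => ?_) (fun j hj1 hjr hlt => ?_) (fun j hj1 hjr => ?_) (fun _ => ?_) (fun j hj1 hj => ?_)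
      (fun l hl h1 hno => ?_) hKL hRA hKA hKAtop he0 hea hεt hεrec
    · by_cases hj : j = 1
      · simp only [hj, if_true]; omega
      · simp only [if_neg hj]; exact hap (j - 1) (by omega) (by omega)
    · by_cases hj : j = 1
      · simp only [hj, if_true, lt_irrefl] at hlt
      · simp only [if_neg hj] at hlt ⊢
        have := hgrow (j - 1) (by omega) (by omega)
        omega
    · by_cases hj : j = 1
      · simp only [hj, if_true]; exact hk2K
      · simp only [if_neg hj]; exact hpK (j - 1) (by omega) (by omega)
    · simp only [if_true]; omega
    · by_cases hj : j = 1
      · subst hj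
        simp only [if_true, show (1 + 1 : ℕ) ≠ 1 by norm_num, if_false, Nat.add_sub_cancel]
        exact hsep0 (by omega)
      · simp only [if_neg hj, if_neg (show j + 1 ≠ 1 by omega), Nat.add_sub_cancel]
        have := hsep (j - 1) (by omega) (by omega)
        rw [show j - 1 + 1 = j by omega] at this
        exact this
    · refine hLa l hl h1 ?_ fun j hj1 hjr => ?_
      · have := hno 1 le_rfl (by omega)
        simp only [if_true] at this
        exact this.1
      · have := hno (j + 1) (by omega) (by omega)
        simp only [if_neg (show j + 1 ≠ 1 by omega), Nat.add_sub_cancel] at this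
        exact this

/-! ## §4 The census four ages with a near MIDDLE pair -/

/-- **THE CENSUS FOUR AGES `{1, k₂, k₃, k₄}` WITH A NEAR MIDDLE PAIR: `56 ≤ k₂ < k₃ ≤ 2k₂`, `61k₃ ≤ k₄`.**  `0 ≤ ε ≤ e` at every pin, every horizon,
every damping of the self-consistent class (`flow_nonneg_young_age_gap_near_pairs` with `a₀ = 1`, the pair level `{k₂, k₃}` at ratio `≥ 30` and the single
level `{k₄}`).  Together with §2 and (E97c): for `k₂ ≥ 56` the two top ratios `k₃∕k₂`, `k₄∕k₃` may each lie in `(1, 2] ∪ [61, ∞)` except both near. [folklore] -/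
theorem flow_nonneg_census_four_ages_near_middle_pair
    (hmono : ∀ u v : ℕ → ℝ, SeqBox γ u → SeqBox γ v → (∀ j, u j ≤ v j) → B u ≤ B v)
    (hL : ∀ k, 0 ≤ L k) (hb : 0 < b) (hlo : ∀ u, SeqBox γ u → b ≤ B u) (hdom : ∀ u, SeqBox γ u → ∑ k ∈ range K, L k * u k ≤ B u)
    (hh : SeqBox γ h) (hf : MemFlow B gIR h) (hg : ∀ t, 0 < g t ∧ g t ≤ 1)
    (hgF : ∀ t, 1 ≤ g t * (1 + ∑ k ∈ range K, L k * h (t + k) ^ 3 / 2))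
    {k₂ k₃ k₄ : ℕ} (hk2 : 56 ≤ k₂) (hk23 : k₂ < k₃) (hk3 : k₃ ≤ 2 * k₂) (hk4 : 61 * k₃ ≤ k₄) (hk4K : k₄ < K)
    (hLa : ∀ l, l < K → l ≠ 1 → l ≠ k₂ → l ≠ k₃ → l ≠ k₄ → L l = 0)
    {N : ℕ} {KL : ℕ → ℕ → ℕ → ℝ}
    (hKL : ∀ k n l, KL k n l = if 0 < k ∧ k < K ∧ l < k then L k * h (n + k) ^ 3 / 2 * ∏ t ∈ Ico (n + 1 + l) (n + k + 1), g t else 0)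
    {KA : ℕ → ℕ → ℕ → ℝ} {RA : ℕ → (ℕ → ℝ) → ℕ → ℝ}
    (hRA : ∀ i v m, RA i v m = ∑ l ∈ range K, KA i m l * v (m + 1 + l))
    (hKA : ∀ i m l, KA i m l = KL i m l + KA (i + 1) m l) (hKAtop : ∀ m l, KA K m l = 0)
    {e ε : ℕ → ℝ} (he0 : ∀ m, 0 ≤ e m) (hea : ∀ m, e (m + 1) ≤ e m)
    (hεt : ∀ m, N < m → ε m = 0) (hεrec : ∀ m, ε m = e m - RA 1 ε m) : ∀ m, 0 ≤ ε m ∧ ε m ≤ e m := by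
  refine flow_nonneg_young_age_gap_near_pairs hmono hL hb hlo hdom hh hf hg hgF (a₀ := 1) le_rfl (by omega)
    (r := 3) (a := fun j => if j = 1 then k₂ else k₄) (p := fun j => if j = 1 then k₃ else k₄) (by norm_num)
    (fun j hj1 hj3 => ?_) (fun j hj1 hj3 hlt => ?_) (fun j hj1 hj3 => ?_) (fun _ => by simpa using (show 30 ≤ k₂ by omega)) (fun j hj1 hj3 => ?_)
    (fun l hl h1 hno => ?_) hKL hRA hKA hKAtop he0 hea hεt hεrec
  · by_cases hj : j = 1
    · simp only [hj, if_true]; omega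
    · simp only [if_neg hj]; omega
  · by_cases hj : j = 1
    · simp only [hj, if_true]; exact hk2
    · simp only [if_neg hj, lt_irrefl] at hlt
  · by_cases hj : j = 1
    · simp only [hj, if_true]; omega
    · simp only [if_neg hj]; exact hk4K
  · have hj : j = 1 := by omega
    subst hj; simp only [if_true, show (1 + 1 : ℕ) ≠ 1 by norm_num, if_false]; exact hk4
  · have h2 := hno 1 le_rfl (by norm_num)
    have h3 := hno 2 (by norm_num) (by norm_num)
    simp only [if_true] at h2
    simp only [show (2 : ℕ) ≠ 1 by norm_num, if_false] at h3
    exact hLa l hl h1 h2.1 h2.2 h3.1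

end Summit.QuantumFields.BalabanUV.Beta.EriceRemainderEnclosureHistoryAutonomyComparisonAgeCompositionNearPairSeparatedAgesEvery
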